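import Mathlib
import Literature.Geometry.DiscreteGeometry.SphericalCodeHemisphere

/-!
# No holes in an all-Good region (stub `stub_noHoles` of `GapTwelveToBarlow`, line `Sketch`)

Support for crux stmt-AtomisticToContinuum-15807 (`SquareWellLayerCake.GapTwelveToBarlow`), card A
(five-fold sparsity): the NO-HOLES input `stub_noHoles` of the landed counting reduction
`stub_fiveFoldSparsity_of_noHoles_of_subcubic`.  Call a site `j` of `x : Fin N → ℝ³` *Good* when
the `11/10`-neighbourhood of `x j` is `55/57`-separated from every other site, exactly twelve other
sites lie within distance `1` of `x j`, and at most twelve within `11/10` (the crux's predicate,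
written out verbatim).  THEOREM (`stub_noHoles`): there are `c > 0` and `D₀` such that whenever
`D ≥ D₀` and every site within `2D` of `x i` is Good, at least `c·D³` sites lie within `D` of
`x i` (here `c = 10⁻⁹`, `D₀ = 250`).

Proof.
* ONE SHELL (`card_shell_le_eleven`).  If `c₀` is Good, the twelve vectors `w = x j − x c₀` to its
  neighbours have norms in `[55/57, 1]` and mutual distances `≥ 55/57`, so the unit vectors
  `w/‖w‖` have pairwise inner products `≤ 1 − (55/57)²/2 ≤ 2·(219/250)² − 1` (`inner_le_of_sep`).
  If moreover every neighbour is at distance `≥ L ≥ 125` from a point `q` at distance exactly `L`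
  from `x c₀`, then `⟪a, w/‖w‖⟫ ≥ −1/250` for the unit vector `a` from `q` to `x c₀`: the twelve
  directions lie in the zone `⟪a, ·⟫ ≥ −1/250` of the sphere.  But at most ELEVEN unit vectors
  with those separations fit in that zone: the open cones of half-angle `arccos (219/250)` about
  them are disjoint and miss the cone of half-angle `arccos (√(1 − (219/250)²) + 1/250)` about `−a`,
  and volumes compare as `N·(1 − 219/250) ≤ 1 + √(1 − (219/250)²) + 1/250 < 12·(31/250)`
  (`card_mul_le_of_code_in_zone`, the zone version of the tree's hemisphere cap-packing bound
  `Literature.Geometry.DiscreteGeometry.card_mul_le_of_code_in_hemisphere`, same proof).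
* NO VOID (`exists_site_near`).  Hence every point `q` within `D/2` of `x i` has a site at distance
  `< 125`: otherwise the site `c₀` closest to `q` is at distance `L ∈ [125, D/2]` from `q`, within
  `D` of `x i`, hence Good, and all its neighbours are at distance `≥ L` from `q` — twelve vectors
  in the forbidden zone.
* COUNT.  The `(2K+1)³` grid points `x i + 250·m`, `m ∈ {−K,…,K}³`, `K = ⌊D/1000⌋`, lie within `D/2`
  of `x i` and are pairwise `≥ 250` apart, so the sites within `125` of them are distinct and within
  `D` of `x i`: at least `(2K+1)³ ≥ (D/1000)³` sites.
No new definitions, no notation; the Good clauses are written out at every use.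
-/

noncomputable section

open scoped RealInnerProductSpace
open MeasureTheory Metric

namespace Summit.AtomisticToContinuum.Crystallization.Theorems.SquareWellLayerCakeGapTwelveToBarlow

open Literature.Geometry.DiscreteGeometry

/-! ### One shell: at most eleven well-separated directions in a zone `⟪a, ·⟫ ≥ −t` -/

/-- **Cones about points of the zone `⟪a, ·⟫ ≥ −t` miss the cone of half-angle
`arccos (√(1−c²) + t)` about `−a`** (zone version of `not_mem_capCone_neg`): if `‖x‖ = 1`,
`⟪a, x⟫ ≥ −t` (`t ≥ 0`) and `y ∈ capCone x c` (`c ≥ 0`), then `y ∉ capCone (−a) (√(1−c²) + t)`,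
since `⟪a, ŷ⟫ ≥ ⟪a, x⟫⟪x, ŷ⟫ − √(1−⟪a,x⟫²)√(1−⟪x,ŷ⟫²) ≥ −t − √(1 − c²)`. -/
theorem not_mem_capCone_neg_of_neg_le {a x y : EuclideanSpace ℝ (Fin 3)} (ha : ‖a‖ = 1)
    (hx : ‖x‖ = 1) {t : ℝ} (ht : 0 ≤ t) (hax : -t ≤ ⟪a, x⟫) {c : ℝ} (hc : 0 ≤ c)
    (hy : y ∈ capCone x c) : y ∉ capCone (-a) (Real.sqrt (1 - c ^ 2) + t) := by
  intro hy'
  have hy0 := ne_zero_of_mem_capCone hy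
  set u : EuclideanSpace ℝ (Fin 3) := ‖y‖⁻¹ • y with hu
  have hun : ‖u‖ = 1 := by
    rw [hu, norm_smul, norm_inv, norm_norm, inv_mul_cancel₀ (norm_ne_zero_iff.2 hy0)]
  have h1 : c < ⟪x, u⟫ := lt_inner_normalise_of_mem_capCone hy
  have h2 : Real.sqrt (1 - c ^ 2) + t < ⟪-a, u⟫ := lt_inner_normalise_of_mem_capCone hy'
  rw [inner_neg_left] at h2
  have htri := inner_mul_inner_sub_sqrt_le hx ha hun
  rw [real_inner_comm a x] at htri
  have hxu1 : ⟪x, u⟫ ≤ 1 := by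
    have := real_inner_le_norm x u; rw [hx, hun, one_mul] at this; exact this
  have hax1 : ⟪a, x⟫ ≤ 1 := by
    have := real_inner_le_norm a x; rw [ha, hx, one_mul] at this; exact this
  have hA : Real.sqrt (1 - ⟪x, u⟫ ^ 2) ≤ Real.sqrt (1 - c ^ 2) := by
    apply Real.sqrt_le_sqrt; nlinarith
  have hB : Real.sqrt (1 - ⟪a, x⟫ ^ 2) ≤ 1 := by
    rw [Real.sqrt_le_one]; nlinarith
  have hs0 : 0 ≤ Real.sqrt (1 - ⟪x, u⟫ ^ 2) := Real.sqrt_nonneg _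
  have hs0' : 0 ≤ Real.sqrt (1 - ⟪a, x⟫ ^ 2) := Real.sqrt_nonneg _
  have hprod : Real.sqrt (1 - ⟪a, x⟫ ^ 2) * Real.sqrt (1 - ⟪x, u⟫ ^ 2) ≤
      1 * Real.sqrt (1 - c ^ 2) := mul_le_mul hB hA hs0 zero_le_one
  have hpos : -t ≤ ⟪a, x⟫ * ⟪x, u⟫ := by
    rcases le_or_gt 0 ⟪a, x⟫ with h0 | h0
    · have := mul_nonneg h0 (hc.trans h1.le); linarith
    · nlinarith
  linarith

/-- **The cap-packing bound in a zone.** Let `v j`, `j ∈ T`, be unit vectors of `ℝ³` with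
pairwise inner products `≤ 2c² − 1` (`0 < c ≤ 1`), all in the zone `⟪a, v j⟫ ≥ −t` of the unit
vector `a` (`0 < t`, `√(1−c²) + t ≤ 1`).  Then `|T|·(1 − c) ≤ 1 + √(1 − c²) + t`: the open cones
of half-angle `arccos c` about the `v j` are pairwise disjoint, lie in the unit ball and miss the
cone of half-angle `arccos (√(1−c²) + t)` about `−a`, and `vol (capCone · c) = (2π/3)(1 − c)`
(the proof of `card_mul_le_of_code_in_hemisphere`, verbatim up to the zone). -/
theorem card_mul_le_of_code_in_zone {ι : Type*} (T : Finset ι)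
    (v : ι → EuclideanSpace ℝ (Fin 3)) (hv1 : ∀ j ∈ T, ‖v j‖ = 1) {c : ℝ} (hc : 0 < c)
    (hc1 : c ≤ 1) (hsep : ∀ j ∈ T, ∀ k ∈ T, j ≠ k → ⟪v j, v k⟫ ≤ 2 * c ^ 2 - 1)
    {a : EuclideanSpace ℝ (Fin 3)} (ha : ‖a‖ = 1) {t : ℝ} (ht : 0 < t)
    (hst : Real.sqrt (1 - c ^ 2) + t ≤ 1) (hzone : ∀ j ∈ T, -t ≤ ⟪a, v j⟫) :
    (T.card : ℝ) * (1 - c) ≤ 1 + Real.sqrt (1 - c ^ 2) + t := by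
  set s := Real.sqrt (1 - c ^ 2) + t with hs
  have hs0 : 0 < s := by positivity
  have hna : ‖-a‖ = 1 := by rw [norm_neg, ha]
  -- the union of the cones sits inside `ball \ capCone (-a) s`
  set U : Set (EuclideanSpace ℝ (Fin 3)) := ⋃ j ∈ T, capCone (v j) c with hU
  have hUsub : U ⊆ ball 0 1 \ capCone (-a) s := by
    intro y hy
    rw [hU, Set.mem_iUnion₂] at hy
    obtain ⟨j, hj, hyj⟩ := hy
    exact ⟨capCone_subset_ball (v j) c hyj,
      not_mem_capCone_neg_of_neg_le ha (hv1 j hj) ht.le (hzone j hj) hc.le hyj⟩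
  -- measure of the union = sum of the cone volumes
  have hdisj : Set.PairwiseDisjoint (↑T : Set ι) fun j => capCone (v j) c := by
    intro j hj k hk hne
    exact disjoint_capCone (hv1 j hj) (hv1 k hk) hc.le hc1 (hsep j hj k hk hne)
  have hUvol : volume U = ∑ j ∈ T, volume (capCone (v j) c) :=
    measure_biUnion_finset hdisj fun j _ => measurableSet_capCone (v j) c
  have hcone : ∀ j ∈ T, volume (capCone (v j) c) = ENNReal.ofReal (2 * Real.pi / 3 * (1 - c)) :=
    fun j hj => volume_capCone (hv1 j hj) hc hc1
  rw [Finset.sum_congr rfl hcone, Finset.sum_const, nsmul_eq_mul] at hUvol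
  -- measure of the difference
  have hdiff : volume (ball (0 : EuclideanSpace ℝ (Fin 3)) 1 \ capCone (-a) s) =
      volume (ball (0 : EuclideanSpace ℝ (Fin 3)) 1) - volume (capCone (-a) s) :=
    measure_sdiff (capCone_subset_ball _ _) (measurableSet_capCone _ _).nullMeasurableSet
      (lt_of_le_of_lt (measure_mono (μ := volume) (capCone_subset_ball (-a) s))
        measure_ball_lt_top).ne
  have hle := measure_mono (μ := volume) hUsub
  rw [hUvol, hdiff, EuclideanSpace.volume_ball_fin_three] at hle
  rw [volume_capCone hna hs0 hst, ← ENNReal.ofReal_pow zero_le_one, one_pow,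
    ENNReal.ofReal_one, one_mul] at hle
  -- pass to real numbers
  have hfin : ENNReal.ofReal (Real.pi * 4 / 3) - ENNReal.ofReal (2 * Real.pi / 3 * (1 - s)) ≠ ⊤ :=
    ENNReal.sub_ne_top ENNReal.ofReal_ne_top
  have hle' := ENNReal.toReal_mono hfin hle
  rw [ENNReal.toReal_mul, ENNReal.toReal_natCast,
    ENNReal.toReal_ofReal (by nlinarith [Real.pi_pos]),
    ENNReal.toReal_sub_of_le (ENNReal.ofReal_le_ofReal (by nlinarith [Real.pi_pos]))
      ENNReal.ofReal_ne_top,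
    ENNReal.toReal_ofReal (by positivity),
    ENNReal.toReal_ofReal (by nlinarith [Real.pi_pos])] at hle'
  -- `|T| · (2π/3)(1 − c) ≤ 4π/3 − (2π/3)(1 − s)`
  have hπ : 0 < 2 * Real.pi / 3 := by positivity
  nlinarith

/-- **Separation to angle.** Two vectors of norms in `[55/57, 1]` at distance `≥ 55/57` have
`⟪w, w'⟫ ≤ (1 − (55/57)²/2)·‖w‖‖w'‖ = (3473/6498)·‖w‖‖w'‖`: with `A = ‖w‖`, `B = ‖w'‖`,
`s = 55/57`, `2⟪w,w'⟫ ≤ A² + B² − s² ≤ (2 − s²)AB` because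
`s²(1 − AB) − (A − B)² = (1−A)(s² − (1−A)) + (1−B)(s² − (1−B)) + (2 − s²)(1−A)(1−B) ≥ 0`. -/
theorem inner_le_of_sep {w w' : EuclideanSpace ℝ (Fin 3)} (hw : 55 / 57 ≤ ‖w‖) (hw1 : ‖w‖ ≤ 1)
    (hw' : 55 / 57 ≤ ‖w'‖) (hw'1 : ‖w'‖ ≤ 1) (hd : 55 / 57 ≤ ‖w - w'‖) :
    ⟪w, w'⟫ ≤ 3473 / 6498 * (‖w‖ * ‖w'‖) := by
  have h1 : ‖w - w'‖ ^ 2 = ‖w‖ ^ 2 - 2 * ⟪w, w'⟫ + ‖w'‖ ^ 2 := norm_sub_sq_real w w'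
  have h2 : (55 / 57 : ℝ) ^ 2 ≤ ‖w - w'‖ ^ 2 := pow_le_pow_left₀ (by norm_num) hd 2
  have k1 : 0 ≤ (1 - ‖w‖) * ((55 / 57 : ℝ) ^ 2 - (1 - ‖w‖)) :=
    mul_nonneg (by linarith) (by nlinarith)
  have k2 : 0 ≤ (1 - ‖w'‖) * ((55 / 57 : ℝ) ^ 2 - (1 - ‖w'‖)) :=
    mul_nonneg (by linarith) (by nlinarith)
  have k3 : 0 ≤ (1 - ‖w‖) * (1 - ‖w'‖) := mul_nonneg (by linarith) (by linarith)
  nlinarith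

/-- **One shell: at most eleven.**  Vectors `w j` (`j ∈ T`) of norms in `[55/57, 1]`, pairwise at
distance `≥ 55/57`, all at distance `≥ L` from the point `−L·a` (`‖a‖ = 1`, `L ≥ 125`) — i.e.
sites of the unit shell about a centre lying on a sphere of radius `L` that contains no site in
its interior — number at most eleven: their directions are unit vectors with pairwise inner
products `≤ 2·(219/250)² − 1` in the zone `⟪a, ·⟫ ≥ −1/250`, and
`12·(1 − 219/250) > 1 + √(1 − (219/250)²) + 1/250` contradicts `card_mul_le_of_code_in_zone`. -/
theorem card_shell_le_eleven {ι : Type*} (T : Finset ι) (w : ι → EuclideanSpace ℝ (Fin 3))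
    (a : EuclideanSpace ℝ (Fin 3)) (ha : ‖a‖ = 1) {L : ℝ} (hL : 125 ≤ L)
    (hlo : ∀ j ∈ T, 55 / 57 ≤ ‖w j‖) (hhi : ∀ j ∈ T, ‖w j‖ ≤ 1)
    (hsep : ∀ j ∈ T, ∀ k ∈ T, j ≠ k → 55 / 57 ≤ ‖w j - w k‖)
    (hfar : ∀ j ∈ T, L ≤ ‖w j + L • a‖) : T.card ≤ 11 := by
  have hpos : ∀ j ∈ T, 0 < ‖w j‖ := fun j hj => lt_of_lt_of_le (by norm_num) (hlo j hj)
  have hv1 : ∀ j ∈ T, ‖(‖w j‖⁻¹ • w j)‖ = 1 := fun j hj =>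
    norm_smul_inv_norm (norm_pos_iff.1 (hpos j hj))
  have hsep' : ∀ j ∈ T, ∀ k ∈ T, j ≠ k →
      ⟪‖w j‖⁻¹ • w j, ‖w k‖⁻¹ • w k⟫ ≤ 2 * (219 / 250 : ℝ) ^ 2 - 1 := by
    intro j hj k hk hne
    have h := inner_le_of_sep (hlo j hj) (hhi j hj) (hlo k hk) (hhi k hk) (hsep j hj k hk hne)
    have hjk : 0 < ‖w j‖ * ‖w k‖ := mul_pos (hpos j hj) (hpos k hk)
    rw [real_inner_smul_left, real_inner_smul_right, ← mul_assoc, ← mul_inv,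
      inv_mul_le_iff₀ hjk]
    nlinarith
  have hzone : ∀ j ∈ T, -(1 / 250 : ℝ) ≤ ⟪a, ‖w j‖⁻¹ • w j⟫ := by
    intro j hj
    have hsq : L ^ 2 ≤ ‖w j + L • a‖ ^ 2 := pow_le_pow_left₀ (by linarith) (hfar j hj) 2
    rw [norm_add_sq_real, real_inner_smul_right, norm_smul, Real.norm_eq_abs,
      abs_of_nonneg (by linarith : (0 : ℝ) ≤ L), ha, mul_one] at hsq
    have hw2 : ‖w j‖ ^ 2 ≤ ‖w j‖ := by nlinarith [hhi j hj, hpos j hj]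
    have key : -‖w j‖ / (2 * L) ≤ ⟪w j, a⟫ := by
      rw [div_le_iff₀ (by linarith)]; nlinarith
    have key' : ‖w j‖ / (2 * L) ≤ ‖w j‖ / 250 :=
      div_le_div_of_nonneg_left (norm_nonneg _) (by norm_num) (by linarith)
    rw [real_inner_smul_right, real_inner_comm, le_inv_mul_iff₀ (hpos j hj)]
    rw [neg_div] at key
    linarith
  have hsqrt : Real.sqrt (1 - (219 / 250 : ℝ) ^ 2) < 121 / 250 := by
    rw [Real.sqrt_lt' (by norm_num)]; norm_num
  have hmain := card_mul_le_of_code_in_zone T (fun j => ‖w j‖⁻¹ • w j) hv1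
    (c := 219 / 250) (by norm_num) (by norm_num) hsep' ha (t := 1 / 250) (by norm_num)
    (by linarith) hzone
  by_contra hcard
  have h12 : (12 : ℝ) ≤ T.card := by exact_mod_cast (by omega : 12 ≤ T.card)
  nlinarith

/-! ### No void near a deep site -/

/-- **No void.** If every site within `2D` of `x i` is Good, every point `q` within `D/2`
of `x i` has a site at distance `< 125`.  Otherwise let `c₀` be the site closest to `q`, at
distance `L ≥ 125`; as `L ≤ dist (x i) q ≤ D/2`, `c₀` is within `D` of `x i`, hence Good, and its
twelve neighbours are at distance `≥ L` from `q`: twelve shell vectors in the configuration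
excluded by `card_shell_le_eleven` (with `a = (x c₀ − q)/L`). -/
theorem exists_site_near {N : ℕ} (x : Fin N → EuclideanSpace ℝ (Fin 3)) (i : Fin N) {D : ℝ}
    (hgood : ∀ j : Fin N, dist (x i) (x j) ≤ 2 * D →
      ((∀ j' : Fin N, dist (x j) (x j') ≤ 11 / 10 → ∀ k : Fin N, k ≠ j' →
          (55 : ℝ) / 57 ≤ dist (x j') (x k)) ∧
        (Finset.univ.filter fun j' : Fin N => j' ≠ j ∧ dist (x j) (x j') ≤ 1).card = 12 ∧
        (Finset.univ.filter fun j' : Fin N => j' ≠ j ∧ dist (x j) (x j') ≤ 11 / 10).card ≤ 12))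
    (q : EuclideanSpace ℝ (Fin 3)) (hq : dist q (x i) ≤ D / 2) :
    ∃ j : Fin N, dist (x j) q < 125 := by
  classical
  by_contra hno
  push Not at hno
  obtain ⟨c₀, -, hmin⟩ :=
    Finset.exists_min_image Finset.univ (fun j => dist (x j) q) ⟨i, Finset.mem_univ i⟩
  set L := dist (x c₀) q with hL
  have hL125 : 125 ≤ L := hno c₀
  have hL0 : 0 < L := by linarith
  have hLD : L ≤ D / 2 := (hmin i (Finset.mem_univ i)).trans (by rwa [dist_comm] at hq)
  have hci : dist (x i) (x c₀) ≤ 2 * D :=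
    calc dist (x i) (x c₀) ≤ dist (x i) q + dist (x c₀) q := dist_triangle_right _ _ _
      _ ≤ D / 2 + D / 2 := add_le_add (by rwa [dist_comm] at hq) hLD
      _ ≤ 2 * D := by linarith
  obtain ⟨hsep, hcard, -⟩ := hgood c₀ hci
  set T := Finset.univ.filter fun j' : Fin N => j' ≠ c₀ ∧ dist (x c₀) (x j') ≤ 1 with hT
  have hmemT : ∀ j ∈ T, j ≠ c₀ ∧ dist (x c₀) (x j) ≤ 1 := fun j hj => (Finset.mem_filter.1 hj).2
  have hxcq : ‖x c₀ - q‖ = L := by rw [hL, dist_eq_norm]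
  set a : EuclideanSpace ℝ (Fin 3) := L⁻¹ • (x c₀ - q) with ha
  have ha1 : ‖a‖ = 1 := by
    rw [ha, norm_smul, norm_inv, Real.norm_eq_abs, abs_of_pos hL0, hxcq, inv_mul_cancel₀ hL0.ne']
  have hLa : L • a = x c₀ - q := by rw [ha, smul_smul, mul_inv_cancel₀ hL0.ne', one_smul]
  have h11 := card_shell_le_eleven T (fun j => x j - x c₀) a ha1 hL125 ?_ ?_ ?_ ?_
  · rw [hcard] at h11
    exact absurd h11 (by norm_num)
  · intro j hj
    have h0 : dist (x c₀) (x c₀) ≤ 11 / 10 := by rw [dist_self]; norm_num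
    have := hsep c₀ h0 j (hmemT j hj).1
    rwa [dist_comm, dist_eq_norm] at this
  · intro j hj
    rw [← dist_eq_norm, dist_comm]
    exact (hmemT j hj).2
  · intro j hj k hk hne
    have h1 : dist (x c₀) (x j) ≤ 11 / 10 := (hmemT j hj).2.trans (by norm_num)
    have := hsep j h1 k hne.symm
    rwa [dist_eq_norm, show x j - x k = (x j - x c₀) - (x k - x c₀) by abel] at this
  · intro j hj
    have := hmin j (Finset.mem_univ j)
    rw [dist_eq_norm] at this
    rwa [hLa, show x j - x c₀ + (x c₀ - q) = x j - q by abel]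

/-! ### The count -/

/-- **No holes** (stub `stub_noHoles` of the skeleton of crux stmt-AtomisticToContinuum-15807, line
`Sketch`; the hypothesis (i) of `stub_fiveFoldSparsity_of_noHoles_of_subcubic`).  There are
`c > 0` (`= 10⁻⁹`) and `D₀` (`= 250`) such that for every configuration `x : Fin N → ℝ³`, site
`i` and `D ≥ D₀`: if every site within `2D` of `x i` is Good, then at least `c·D³` sites lie within
`D` of `x i`.  Proof: the `(2K+1)³ ≥ (D/1000)³` grid points `x i + 250·(m − K)`, `m ∈ {0,…,2K}³`,
`K = ⌊D/1000⌋`, are within `D/2` of `x i` and pairwise `≥ 250` apart; by `exists_site_near` each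
has a site within `125`, and these sites are distinct and within `D` of `x i`. -/
theorem stub_noHoles :
    ∃ c : ℝ, 0 < c ∧ ∃ D₀ : ℝ, ∀ (N : ℕ) (x : Fin N → EuclideanSpace ℝ (Fin 3))
      (i : Fin N) (D : ℝ), D₀ ≤ D →
      (∀ j : Fin N, dist (x i) (x j) ≤ 2 * D →
        ((∀ j' : Fin N, dist (x j) (x j') ≤ 11 / 10 → ∀ k : Fin N, k ≠ j' →
            (55 : ℝ) / 57 ≤ dist (x j') (x k)) ∧
          (Finset.univ.filter fun j' : Fin N => j' ≠ j ∧ dist (x j) (x j') ≤ 1).card = 12 ∧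
          (Finset.univ.filter fun j' : Fin N => j' ≠ j ∧ dist (x j) (x j') ≤ 11 / 10).card ≤ 12)) →
      c * D ^ 3 ≤ (Finset.univ.filter fun j : Fin N => dist (x i) (x j) ≤ D).card := by
  classical
  refine ⟨1 / 1000 ^ 3, by positivity, 250, ?_⟩
  intro N x i D hD hgood
  have hD0 : 0 ≤ D := by linarith
  set K : ℕ := ⌊D / 1000⌋₊ with hK
  have hK1 : (K : ℝ) ≤ D / 1000 := Nat.floor_le (by positivity)
  have hK2 : D / 1000 < K + 1 := Nat.lt_floor_add_one _
  -- the grid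
  set e : Fin (2 * K + 1) × Fin (2 * K + 1) × Fin (2 * K + 1) → EuclideanSpace ℝ (Fin 3) :=
    fun m => !₂[((m.1 : ℕ) : ℝ) - K, ((m.2.1 : ℕ) : ℝ) - K, ((m.2.2 : ℕ) : ℝ) - K] with he
  set p : Fin (2 * K + 1) × Fin (2 * K + 1) × Fin (2 * K + 1) → EuclideanSpace ℝ (Fin 3) :=
    fun m => x i + (250 : ℝ) • e m with hp
  have hcoord : ∀ m : Fin (2 * K + 1) × Fin (2 * K + 1) × Fin (2 * K + 1),
      ∀ n : Fin (2 * K + 1), |((n : ℕ) : ℝ) - K| ≤ K := by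
    intro m n
    have h1 : ((n : ℕ) : ℝ) ≤ 2 * K := by
      have := n.is_lt
      have : (n : ℕ) ≤ 2 * K := by omega
      exact_mod_cast this
    have h2 : (0 : ℝ) ≤ (n : ℕ) := Nat.cast_nonneg _
    rw [abs_le]; constructor <;> linarith
  have hnorm : ∀ m, ‖e m‖ ≤ 2 * K := by
    intro m
    have hsq : ‖e m‖ ^ 2 = (((m.1 : ℕ) : ℝ) - K) ^ 2 + (((m.2.1 : ℕ) : ℝ) - K) ^ 2 +
        (((m.2.2 : ℕ) : ℝ) - K) ^ 2 := by
      rw [he, EuclideanSpace.norm_eq, Real.sq_sqrt (by positivity), Fin.sum_univ_three]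
      simp [Real.norm_eq_abs, sq_abs]
    have ha := hcoord m m.1
    have hb := hcoord m m.2.1
    have hc := hcoord m m.2.2
    rw [abs_le] at ha hb hc
    have hK0 : (0 : ℝ) ≤ K := Nat.cast_nonneg _
    nlinarith [norm_nonneg (e m)]
  have hdist : ∀ m, dist (p m) (x i) ≤ D / 2 := by
    intro m
    rw [hp, dist_eq_norm, add_sub_cancel_left, norm_smul, Real.norm_eq_abs,
      abs_of_pos (by norm_num : (0 : ℝ) < 250)]
    nlinarith [hnorm m]
  -- distinct naturals are at distance `≥ 1`
  have hnat : ∀ {a b : ℕ}, a ≠ b → (1 : ℝ) ≤ |(a : ℝ) - b| := by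
    intro a b h
    rcases Nat.lt_or_gt_of_ne h with h | h
    · have : (a : ℝ) + 1 ≤ b := by exact_mod_cast h
      rw [abs_sub_comm, abs_of_nonneg (by linarith)]; linarith
    · have : (b : ℝ) + 1 ≤ a := by exact_mod_cast h
      rw [abs_of_nonneg (by linarith)]; linarith
  have hfar : ∀ m m', m ≠ m' → (250 : ℝ) ≤ dist (p m) (p m') := by
    intro m m' hne
    have hsub : p m - p m' = (250 : ℝ) • (e m - e m') := by
      rw [hp]; simp only [smul_sub]; abel
    rw [dist_eq_norm, hsub, norm_smul, Real.norm_eq_abs, abs_of_pos (by norm_num : (0 : ℝ) < 250)]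
    suffices h1 : (1 : ℝ) ≤ ‖e m - e m'‖ by nlinarith
    have hk : ∀ k : Fin 3, |(e m).ofLp k - (e m').ofLp k| ≤ ‖e m - e m'‖ := fun k => by
      simpa [Real.norm_eq_abs] using PiLp.norm_apply_le (e m - e m') k
    by_cases h1 : m.1 = m'.1
    · by_cases h2 : m.2.1 = m'.2.1
      · have h3 : m.2.2 ≠ m'.2.2 := fun h3 => hne (Prod.ext h1 (Prod.ext h2 h3))
        refine le_trans ?_ (hk 2)
        have := hnat (Fin.val_ne_of_ne h3)
        simpa [he] using this
      · refine le_trans ?_ (hk 1)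
        have := hnat (Fin.val_ne_of_ne h2)
        simpa [he] using this
    · refine le_trans ?_ (hk 0)
      have := hnat (Fin.val_ne_of_ne h1)
      simpa [he] using this
  -- a site near every grid point
  have hex : ∀ m, ∃ j : Fin N, dist (x j) (p m) < 125 := fun m =>
    exists_site_near x i hgood (p m) (hdist m)
  choose f hf using hex
  have hinj : Function.Injective f := by
    intro m m' hmm'
    by_contra hne
    have h1 := hf m
    have h2 := hf m'
    rw [← hmm'] at h2
    have := dist_triangle_left (p m) (p m') (x (f m))
    linarith [hfar m m' hne]
  have himg : Finset.univ.image f ⊆ Finset.univ.filter fun j : Fin N => dist (x i) (x j) ≤ D := by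
    intro j hj
    obtain ⟨m, -, rfl⟩ := Finset.mem_image.1 hj
    refine Finset.mem_filter.2 ⟨Finset.mem_univ _, ?_⟩
    calc dist (x i) (x (f m)) ≤ dist (p m) (x i) + dist (x (f m)) (p m) := by
          rw [dist_comm (p m) (x i)]; exact dist_triangle_right _ _ _
      _ ≤ D / 2 + 125 := add_le_add (hdist m) (hf m).le
      _ ≤ D := by linarith
  have hcardG : (2 * K + 1) ^ 3 ≤ (Finset.univ.filter fun j : Fin N => dist (x i) (x j) ≤ D).card := by
    have := Finset.card_le_card himg
    rw [Finset.card_image_of_injective _ hinj, Finset.card_univ] at this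
    have h3 : Fintype.card (Fin (2 * K + 1) × Fin (2 * K + 1) × Fin (2 * K + 1)) =
        (2 * K + 1) ^ 3 := by
      simp only [Fintype.card_prod, Fintype.card_fin]; ring
    rwa [h3] at this
  have hcast : ((2 * K + 1 : ℕ) : ℝ) ^ 3 ≤
      ((Finset.univ.filter fun j : Fin N => dist (x i) (x j) ≤ D).card : ℝ) := by
    exact_mod_cast hcardG
  have hle : D / 1000 ≤ ((2 * K + 1 : ℕ) : ℝ) := by push_cast; linarith [(Nat.cast_nonneg K : (0:ℝ) ≤ K)]
  have hpow : (D / 1000) ^ 3 ≤ ((2 * K + 1 : ℕ) : ℝ) ^ 3 := pow_le_pow_left₀ (by positivity) hle 3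
  calc 1 / 1000 ^ 3 * D ^ 3 = (D / 1000) ^ 3 := by ring
    _ ≤ _ := hpow.trans hcast

end Summit.AtomisticToContinuum.Crystallization.Theorems.SquareWellLayerCakeGapTwelveToBarlow

end
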